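import Summits.KontsevichZagierPeriods.Zeta5Search.Certificates.TwoTaleTelescopeKitU

/-!
# ζ(2) two-tale line — kit supplement: univariate polynomial arithmetic and non-vanishing certificates (cell `pub-zeta5`, `cert-2`)

HONEST FRAMING: systematic search; recurrence certificates; no irrationality claim unless certified.

Tools for the (S3) part of the aef-direction FAMILY certificates (`certs/tele/bmiss_general/PROOF.md` §3): integer coefficient
lists with Horner semantics `uval` (bridged to the encoded `upvalN` of `TwoTaleTelescopeKitU`), list arithmetic `uadd`, `usmul`,
`umul` (products — used to replay the PROPORTIONALITY `hd·C_k^R = hn·c_k^L` of the two operators of a family by one `decide`),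
the Taylor shift `ushift b p` (coefficients of `P(b+n)` in `n`), and the Boolean SIGN CERTIFICATE `signCert p b`: the shifted
coefficients are all `≥ 0` with constant term `> 0` (or all `≤ 0` with constant term `< 0`), which gives `P(a) ≠ 0` for every
integer `a ≥ b` (`uval_ne_zero_of_signCert`). General tooling; no named facts.
-/

namespace Summit.KontsevichZagierPeriods.Zeta5Search.Certificates

namespace TwoTaleTelescope

variable {R : Type*} [CommRing R]

/-- Horner value `Σ_i p[i] · a^i` of an integer coefficient list (low degree first). -/
def uval : List ℤ → R → R
  | [], _ => 0
  | c :: cs, a => (c : R) + a * uval cs a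

/-- `uval [] a = 0`. -/
@[simp] theorem uval_nil (a : R) : uval [] a = 0 := rfl

/-- Horner step. -/
@[simp] theorem uval_cons (c : ℤ) (cs : List ℤ) (a : R) : uval (c :: cs) a = (c : R) + a * uval cs a := rfl

/-- Bridge to the encoded lists of `TwoTaleTelescopeKitU`. -/
theorem upvalN_eq_uval (a : R) : ∀ cs : List ℕ, upvalN cs a = uval (cs.map zdec) a
  | [] => by rw [upvalN, List.map_nil, uval_nil]
  | c :: cs => by rw [upvalN, List.map_cons, uval_cons, upvalN_eq_uval a cs]

/-- `upvalN` at an integer argument, cast. -/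
theorem upvalN_intCast (a : ℤ) : ∀ cs : List ℕ, upvalN cs (a : R) = ((upvalN cs a : ℤ) : R)
  | [] => by rw [upvalN, upvalN]; push_cast; rfl
  | c :: cs => by rw [upvalN, upvalN, upvalN_intCast a cs]; push_cast; rfl

/-- Non-vanishing transfers from `ℤ` to any commutative ring of characteristic zero. -/
theorem upvalN_cast_ne_zero [CharZero R] (cs : List ℕ) (a : ℤ) (h : (upvalN cs a : ℤ) ≠ 0) : upvalN cs (a : R) ≠ 0 := by
  rw [upvalN_intCast]; exact Int.cast_ne_zero.mpr h

/-- Coefficientwise sum. -/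
def uadd : List ℤ → List ℤ → List ℤ
  | [], q => q
  | c :: p, [] => c :: p
  | c :: p, d :: q => (c + d) :: uadd p q

/-- Semantics of `uadd`. -/
theorem uval_uadd (a : R) : ∀ p q : List ℤ, uval (uadd p q) a = uval p a + uval q a
  | [], q => by rw [uadd, uval_nil, zero_add]
  | c :: p, [] => by rw [uadd, uval_nil, add_zero]
  | c :: p, d :: q => by rw [uadd, uval_cons, uval_cons, uval_cons, uval_uadd a p q]; push_cast; ring

/-- Scalar multiple. -/
def usmul (b : ℤ) : List ℤ → List ℤ
  | [] => []
  | c :: p => (b * c) :: usmul b p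

/-- Semantics of `usmul`. -/
theorem uval_usmul (b : ℤ) (a : R) : ∀ p : List ℤ, uval (usmul b p) a = (b : R) * uval p a
  | [] => by rw [usmul, uval_nil, mul_zero]
  | c :: p => by rw [usmul, uval_cons, uval_cons, uval_usmul b a p]; push_cast; ring

/-- Product of coefficient lists. -/
def umul : List ℤ → List ℤ → List ℤ
  | [], _ => []
  | c :: p, q => uadd (usmul c q) (0 :: umul p q)

/-- Semantics of `umul`. -/
theorem uval_umul (a : R) : ∀ p q : List ℤ, uval (umul p q) a = uval p a * uval q a
  | [], q => by rw [umul, uval_nil, zero_mul]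
  | c :: p, q => by rw [umul, uval_uadd, uval_usmul, uval_cons, uval_cons, uval_umul a p q]; push_cast; ring

/-- PROPORTIONALITY transfer: a product identity of coefficient lists gives the identity of values in any commutative ring. -/
theorem upvalN_mul_eq_of_umul (p q r s : List ℕ) (h : umul (p.map zdec) (q.map zdec) = umul (r.map zdec) (s.map zdec))
    (a : R) : upvalN p a * upvalN q a = upvalN r a * upvalN s a := by
  rw [upvalN_eq_uval, upvalN_eq_uval, upvalN_eq_uval, upvalN_eq_uval, ← uval_umul, ← uval_umul, h]

/-- From `hd·x = hn·y` with `hn ≠ 0`, `y ≠ 0` (in `ℤ`): `x ≠ 0`. -/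
theorem ne_zero_of_prop_int {x y hn hd : ℤ} (h : hd * x = hn * y) (h1 : hn ≠ 0) (h2 : y ≠ 0) : x ≠ 0 := by
  rintro rfl
  exact mul_ne_zero h1 h2 (by simpa using h.symm)

/-- Taylor shift: `ushift b p` are the coefficients of `P(b + n)` as a polynomial in `n`. -/
def ushift (b : ℤ) : List ℤ → List ℤ
  | [] => []
  | c :: p => uadd [c] (uadd (usmul b (ushift b p)) (0 :: ushift b p))

/-- Semantics of `ushift`. -/
theorem uval_ushift (b : ℤ) (n : R) : ∀ p : List ℤ, uval (ushift b p) n = uval p ((b : R) + n)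
  | [] => by rw [ushift, uval_nil, uval_nil]
  | c :: p => by
      rw [ushift, uval_uadd, uval_uadd, uval_usmul]
      simp only [uval_cons, uval_nil, uval_ushift b n p]
      push_cast; ring

/-- Non-negative coefficients at a non-negative integer argument give a non-negative value. -/
theorem uval_nonneg_int : ∀ p : List ℤ, (∀ c ∈ p, 0 ≤ c) → ∀ n : ℤ, 0 ≤ n → 0 ≤ uval p n
  | [], _, n, _ => by rw [uval_nil]
  | c :: p, h, n, hn => by
      rw [uval_cons, Int.cast_id]
      have hc : 0 ≤ c := h c (by simp)
      have hp : 0 ≤ uval p n := uval_nonneg_int p (fun d hd => h d (by simp [hd])) n hn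
      exact add_nonneg hc (mul_nonneg hn hp)

/-- Non-positive coefficients at a non-negative integer argument give a non-positive value. -/
theorem uval_nonpos_int : ∀ p : List ℤ, (∀ c ∈ p, c ≤ 0) → ∀ n : ℤ, 0 ≤ n → uval p n ≤ 0
  | [], _, n, _ => by rw [uval_nil]
  | c :: p, h, n, hn => by
      rw [uval_cons, Int.cast_id]
      have hc : c ≤ 0 := h c (by simp)
      have hp : uval p n ≤ 0 := uval_nonpos_int p (fun d hd => h d (by simp [hd])) n hn
      nlinarith

/-- SIGN CERTIFICATE at `b`: the coefficients of `P(b+n)` are all `≥ 0` with constant term `> 0`, or all `≤ 0` with constant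
term `< 0`. -/
def signCert (p : List ℤ) (b : ℤ) : Bool :=
  match ushift b p with
  | [] => false
  | c :: q => (decide (0 < c) && q.all fun d => decide (0 ≤ d)) || (decide (c < 0) && q.all fun d => decide (d ≤ 0))

/-- A sign certificate at `b` gives `P(a) ≠ 0` for every integer `a ≥ b`. -/
theorem uval_ne_zero_of_signCert (p : List ℤ) (b : ℤ) (h : signCert p b = true) (a : ℤ) (ha : b ≤ a) : uval p a ≠ 0 := by
  have e : uval p a = uval (ushift b p) (a - b) := by rw [uval_ushift, Int.cast_id, add_sub_cancel]
  rw [e]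
  have hn : 0 ≤ a - b := by linarith
  cases hq : ushift b p with
  | nil => simp [signCert, hq] at h
  | cons c q =>
      simp only [signCert, hq, Bool.or_eq_true, Bool.and_eq_true, decide_eq_true_eq, List.all_eq_true] at h
      rw [uval_cons, Int.cast_id]
      rcases h with ⟨hc, hq'⟩ | ⟨hc, hq'⟩
      · have := uval_nonneg_int q hq' (a - b) hn
        nlinarith
      · have := uval_nonpos_int q hq' (a - b) hn
        nlinarith

/-- The same for an encoded list of `TwoTaleTelescopeKitU`, valued in `ℤ`. -/
theorem upvalN_int_ne_zero_of_signCert (cs : List ℕ) (b : ℤ) (h : signCert (cs.map zdec) b = true) (a : ℤ) (ha : b ≤ a) :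
    (upvalN cs a : ℤ) ≠ 0 := by
  rw [upvalN_eq_uval]; exact uval_ne_zero_of_signCert _ b h a ha

end TwoTaleTelescope

end Summit.KontsevichZagierPeriods.Zeta5Search.Certificates
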